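import Summits.QuantumFields.BalabanUV.T4Continuum.Support.NE9ChartFaceTable
import Summits.QuantumFields.BalabanUV.T4Continuum.Support.B13TermHistSecant

/-!
# NE9ChartFaceActivitySecant — WALL §2 ROW A1, TABLE CLAUSE, SOURCED FROM NE5's DISPLAYED PER-ACTIVITY SHAPES: the history
# secant of NE5's activity of record `activity (b13InnerData R) S.act` from `ActExpLinearOn` ∕ `ActExpNormBound` ∕ `ActAbsBound`
# (the SAME three binders NE5's END of record displays — `B13StepOfRecordSecantShapes.ne5_of_record_secant_shapes` `hexp ∕ hN ∕ habs`)
# at SINGLETON tuples, and the table two-point clause of `actNE9` ∕ `actChart … (iRecC …)` from it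
# (cell `pub-balaban`, T4-DAG §2 node U3 ∕ §6 NE9; BINDER row NE9 OWNER lineage `b2b-balaban-t4-ne9-p1`, generation 33; follows
# `NE9ChartFaceTable` (p224660) §3, whose NE5-side hypothesis `hH` this file PRODUCES from NE5's shapes)

HONEST FRAMING (T4-DAG PAGE 1).  Rung (B)+1 of the FINITE-VOLUME T⁴ programme — NOT infinite volume, NOT a mass gap, NOT the
Clay problem.  NE9 (`T4OutputRate.NE9` ∧ `FadingMemory`) is a cell NEW ESTIMATE, NOT PRINTED in [I] = [Balaban1987RG1]
(CMP **109**), [II] = [Balaban1988RG2Cluster] (CMP **116**), and NOT PROVED for Bałaban's E^{(j)} («NE9 ⇐ the named binders»;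
0∕18 leaves instantiated on Bałaban's objects; spine PROVED 0∕9).  HONEST DEPENDENCY (cell line, verbatim): continuum YM on T⁴ ⇐
BetaPertH ∧ nine spine estimates (0/9 proved); BetaPertH ⇐ (D1) ∧ (D4) ∧ CAP+tail; G-an2-4 gates asym, D1 and NE2/3/4.
`FlowStep.BetaPertH`, (B), (B^μ) do not occur.  One real-valued DATA def (`secMod`) + kernel bookkeeping over NE5's hypothesis
SHAPES (asserted nowhere); no estimate of any object of the series; quotations for TYPES only (ABSOLUTE RULE).  0 sorry.

WHY THIS FILE.  WALL-NE9-P1 §2 row A1 (`hKP : TwoPointKP G W act 𝒜 n lip a d`) has three clauses; its TABLE clause (ii) —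
`‖act k (g k) U Q γ − act k (g k) U Q′ γ‖ ≤ lip k·‖Q − Q′‖·n k (g k) U γ` for admissible tables — compares TWO TABLES and is NOT
PRINTED ([II] bounds one table: (2.15) p. 15, Lemma 3 (2.38) p. 20); the WALL classes it «(B)'s interior (R-1)».  At the chart
face (`NE9ChartFaceTable` §3) it was reduced to a Hist-Lipschitz clause `hH` on NE5's activity of record plus the Lipschitz
sourcing map `iRecC`.  NE5's END of record ALREADY DISPLAYS, for its own two-run history comparison, three per-activity SHAPES
on its class `K k g U ⊆ OpDatum E × Hist` — the exp-linear STRUCTURE `ActExpLinearOn` ((2.14) p. 15: the potentials enter only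
through `exp[Σ_Y τ(Y)𝐕_k(Y,B)]`), the exponent bound `ActExpNormBound … r N` ((2.18)∕(2.20) p. 16 KIND) and the absolute
majorant `ActAbsBound … A` ((2.15)∕(2.38) KIND) — and proves from them the secant of every URSELL TERM
(`B13TermHistSecant.norm_term_sub_term_le`).  THIS FILE proves the secant at the level NE9 reads — ONE ACTIVITY `H(Z) =
Σ_ℓ act Z ℓ o h` — by evaluating the three shapes at SINGLETON tuples, so that NE9's A1 table clause costs NO hypothesis beyond
NE5's displayed W2-hist binders, the membership of the chart-sourced pairs in NE5's class, and a currency domination: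
* §1 `single Z ℓ` (the one-factor term label `⟨0, (Z; ℓ)⟩`) and **`rel_single`**: it localizes at `Z` itself at step `k` iff
  `scale Z = k` and `ℓ ∈ innerLabels D k Z` (the cover `∪Zᵢ = X` of (2.13) is trivial for one factor);
* §2 **`norm_act_sub_act_le_of_shapes`**: at two class points `(o, h)`, `(o, h′)` of step `k`, for `scale Z = k`,
  `ℓ ∈ innerLabels D k Z`: `‖act Z ℓ o h − act Z ℓ o h′‖ ≤ (2·N k g U Z ℓ·A k g U Z ℓ ∕ r k)·‖h − h′‖` — the tree's kernel
  `T4InputCauchyRateSecant.norm_integral_mul_cexp_sub_le` (secant of the exponential under the integral sign; the two endpoint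
  absolute majorants each `≤ A`); DATA `secMod D N A r k Z := Σ_{ℓ ∈ innerLabels D k Z} 2·N Z ℓ·A Z ℓ ∕ r` and
  **`norm_activity_sub_activity_le_of_shapes`**: `‖activity D act k o h Z − activity D act k o h′ Z‖ ≤ secMod …·‖h − h′‖`;
* §3 on the carriers of record: **`tableTwoPoint_actNE9_of_shapes`** — table-blind `oRec` (D-6), a sourcing map `iRec` Lipschitz
  `L k` on `𝒜 k`, the chart-sourced pairs `(oRec k (g k) ξ Q, iRec k (g k) ξ Q)`, `Q ∈ 𝒜 k`, chart points `ξ`, IN NE5's CLASS `K (k+1) g (υ ξ)`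
  (DISPLAYED — `υ` the real background indexing the class, e.g. the chart centre; a continuity statement about the substrate's
  chart, cf. S-HOLO-AN ∕ VECJ-H), and the CURRENCY DOMINATION `secMod … (k+1) … Z ≤ lipH k·n₅ k (g k) ξ Z` (DISPLAYED, S∕T: the
  secant modulus against NE9's common majorant `n₅` of clauses (i)∕(iii)) ⇒ clause (ii) of
  `U3PolymerDictionaryKP.twoPointKP_cubeChart_of_domains` for `actNE9 S oRec iRec` with `lip k := lipH k·L k`;
  **`tableTwoPoint_actChart_iRecC_of_shapes`** — the same for `actChart S raw ch (iRecC P c w)` under REG, `lip k := lipH k·combWt w`.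
NET EFFECT ON WALL §2: A1's table clause ↦ K modulo {NE5's `hexp ∕ hN ∕ habs` (shared T-rows, already on NE5's END), class
membership of the sourced pairs (M∕T), currency domination (S), REG}.  Clauses (i) (size) and (iii) (Kotecký–Preiss) of A1 are
untouched (NE5's `habs` + (2.38) SHAPE, `U3PolymerDictionaryKP`).  DISGUISE TEST: a secant inequality for an exp-linear integral,
summed over a finite label catalogue, composed with a Lipschitz map; no activity of Bałaban's is estimated; not NE9.

References (TYPES ∕ loci only): [Balaban1988RG2Cluster] T. Bałaban, CMP **116** (1988) 1–22, (2.9)–(2.15) pp. 14–15, (2.18)–(2.20)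
p. 16, Lemma 3 (2.38) p. 20.  Summits-side NEW work (LEAN PLACEMENT RULE); imports `NE9ChartFaceTable` (p224660) and NE5's
`B13TermHistSecant` (leaf-03) BY NAME; modifies nothing.  Value = one NOT-PRINTED binder of row NE9 traded for binders NE5
already displays, NOT summit progress.
-/

noncomputable section

open scoped BigOperators
open MeasureTheory

namespace Summit.QuantumFields.BalabanUV.T4Continuum.NE9ChartFaceActivitySecant

open Literature.MathematicalPhysics.QuantumFieldTheory.Balaban1983to89
open Literature.MathematicalPhysics.QuantumFieldTheory.Balaban1983to89.T4OutputRate (Carriers)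
open Literature.MathematicalPhysics.QuantumFieldTheory.Balaban1983to89.T4InputCauchyRateSecant (norm_integral_mul_cexp_sub_le)
open Summit.QuantumFields.BalabanUV.T4Continuum.ClusterRepOfDomains (DomainGeometry)
open Summit.QuantumFields.BalabanUV.T4Continuum.B13StepTermLabels
open Summit.QuantumFields.BalabanUV.T4Continuum.B13StepTermFamily (ActData ActExpLinearOn)
open Summit.QuantumFields.BalabanUV.T4Continuum.B13StepTermSocket (labelsIndexing rel_iff)
open Summit.QuantumFields.BalabanUV.T4Continuum.B13OutKPForm (activity)
open Summit.QuantumFields.BalabanUV.T4Continuum.B13TermHistSecant (ActExpNormBound ActAbsBound)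

/-! ## §1 Singleton tuples localize at their own polymer -/

section Single

variable {C : Carriers} [DecidableEq C.Dom] {Cube : Type*} [DecidableEq Cube] {Bnd : Type*} [DecidableEq Bnd]
  (G : DomainGeometry C Cube) (D : InnerData C Bnd)

/-- [folklore] DATA: the ONE-FACTOR term label `⟨0, (Z; ℓ)⟩` (the `n = 1` term of (2.13) with the resummed term `ℓ` of `H(Z)`).
[cite: Balaban1988RG2Cluster, (2.13)-(2.14) pp.14-15] -/
def single (Z : C.Dom) (ℓ : InnerLabel C.Dom Bnd) : TermIdx C.Dom Bnd := ⟨0, fun _ => ⟨Z, ℓ⟩⟩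

omit [DecidableEq C.Dom] [DecidableEq Bnd] in
/-- [folklore] the polymer of the singleton tuple. -/
@[simp] theorem polys_single (Z : C.Dom) (ℓ : InnerLabel C.Dom Bnd) (m : Fin (0 + 1)) : (single Z ℓ).polys m = Z := rfl

/-- [folklore] **A SINGLETON TUPLE LOCALIZES AT ITS OWN POLYMER**: `scale Z = k` and `ℓ ∈ innerLabels D k Z` give
`(labelsIndexing G D).Rel k (single Z ℓ) Z` (footprint inclusion is reflexive, the cover `∪Zᵢ = Z` is trivial). -/
theorem rel_single {k : ℕ} {Z : C.Dom} (hZ : C.scale Z = k) {ℓ : InnerLabel C.Dom Bnd} (hℓ : ℓ ∈ innerLabels D k Z) :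
    (labelsIndexing G D).Rel k (single Z ℓ) Z := by
  refine (rel_iff G D).2 ⟨hZ, ?_, ?_⟩
  · intro i
    exact ⟨(G.mem_level Z k).2 hZ, subset_rfl, (mem_innerLabels D).1 hℓ⟩
  · unfold Covers
    ext c
    simp [single, TermIdx.polys]

end Single

/-! ## §2 The history secant of ONE activity term and of ONE activity from NE5's three per-activity shapes -/

section Secant

variable {C : Carriers} [DecidableEq C.Dom] {Cube : Type*} [DecidableEq Cube] {Bnd : Type*} [DecidableEq Bnd]
  (G : DomainGeometry C Cube) (D : InnerData C Bnd) {Op Hist Ω : Type*} [NormedAddCommGroup Hist] [NormedSpace ℂ Hist]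
  [MeasurableSpace Ω] (act : C.Dom → InnerLabel C.Dom Bnd → Op → Hist → ℂ)

/-- [folklore] DATA: **THE ACTIVITY SECANT MODULUS** induced by per-term exponent bounds `N`, absolute majorants `A` and the history
unit `r`: `Σ_{ℓ ∈ innerLabels D k Z} 2·N Z ℓ·A Z ℓ ∕ r`. [cite: Balaban1988RG2Cluster, (2.15) p.15 and (2.18)-(2.20) p.16] -/
def secMod (N A : C.Dom → InnerLabel C.Dom Bnd → ℝ) (r : ℝ) (k : ℕ) (Z : C.Dom) : ℝ :=
  ∑ ℓ ∈ innerLabels D k Z, 2 * N Z ℓ * A Z ℓ / r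

omit [DecidableEq Cube] in
/-- [folklore] `0 ≤ secMod` for `N, A ≥ 0`, `r > 0`. -/
theorem secMod_nonneg {N A : C.Dom → InnerLabel C.Dom Bnd → ℝ} {r : ℝ} (hN : ∀ Z ℓ, 0 ≤ N Z ℓ) (hA : ∀ Z ℓ, 0 ≤ A Z ℓ)
    (hr : 0 < r) (k : ℕ) (Z : C.Dom) : 0 ≤ secMod D N A r k Z :=
  Finset.sum_nonneg fun ℓ _ => div_nonneg (mul_nonneg (mul_nonneg zero_le_two (hN Z ℓ)) (hA Z ℓ)) hr.le

variable {G D act}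

/-- [folklore] **THE HISTORY SECANT OF ONE ACTIVITY TERM FROM NE5's SHAPES.**  Under `ActExpLinearOn (labelsIndexing G D) act Dt K W`
(STRUCTURE), `ActExpNormBound … r N` and `ActAbsBound … A` (DISPLAYED per-activity binders of NE5's END, printed KIND (2.14)∕(2.15)∕
(2.18)–(2.20)∕(2.38) of [II] — asserted nowhere), `r k > 0`: at two class points `(o, h)`, `(o, h′) ∈ K k g U`, for a step-`k` polymer
`Z` and a well-formed inner label `ℓ`, `‖act Z ℓ o h − act Z ℓ o h′‖ ≤ (2·N k g U Z ℓ·A k g U Z ℓ ∕ r k)·‖h − h′‖` — the tree's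
`norm_integral_mul_cexp_sub_le` at the singleton tuple. [cite: Balaban1988RG2Cluster, (2.14)-(2.15) p.15 and (2.18)-(2.20) p.16] -/
theorem norm_act_sub_act_le_of_shapes {K : ℕ → (ℕ → ℝ) → C.BgB → Set (Op × Hist)} {W : Set (ℕ → ℝ)}
    {Dt : ActData C.Dom (InnerLabel C.Dom Bnd) Op Hist Ω} {r : ℕ → ℝ}
    {N A : ℕ → (ℕ → ℝ) → C.BgB → C.Dom → InnerLabel C.Dom Bnd → ℝ}
    (hexp : ActExpLinearOn (labelsIndexing G D) act Dt K W) (hN : ActExpNormBound (labelsIndexing G D) Dt K W r N)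
    (habs : ActAbsBound (labelsIndexing G D) Dt K W A) (hN0 : ∀ k g U Z ℓ, 0 ≤ N k g U Z ℓ) (hr : ∀ k, 0 < r k)
    {k : ℕ} {g : ℕ → ℝ} (hg : g ∈ W) {U : C.BgB} {o : Op} {h h' : Hist} (hq : (o, h) ∈ K k g U) (hq' : (o, h') ∈ K k g U)
    {Z : C.Dom} (hZ : C.scale Z = k) {ℓ : InnerLabel C.Dom Bnd} (hℓ : ℓ ∈ innerLabels D k Z) :
    ‖act Z ℓ o h - act Z ℓ o h'‖ ≤ 2 * N k g U Z ℓ * A k g U Z ℓ / r k * ‖h - h'‖ := by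
  have hR : (labelsIndexing G D).Rel k (single Z ℓ) Z := rel_single G D hZ hℓ
  have hrepr : act Z ℓ o h = ∫ a, Dt.Φ Z ℓ o a * Complex.exp (Dt.Λ Z ℓ o a h) ∂(Dt.ν Z ℓ o) :=
    hexp.repr k g hg U (o, h) hq Z hZ (single Z ℓ) hR 0
  have hrepr' : act Z ℓ o h' = ∫ a, Dt.Φ Z ℓ o a * Complex.exp (Dt.Λ Z ℓ o a h') ∂(Dt.ν Z ℓ o) :=
    hexp.repr k g hg U (o, h') hq' Z hZ (single Z ℓ) hR 0
  have hint : Integrable (Dt.Φ Z ℓ o) (Dt.ν Z ℓ o) := hexp.integrable k g hg U (o, h) hq Z hZ (single Z ℓ) hR 0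
  have hmeas : ∀ y : Hist, AEStronglyMeasurable (fun a => Dt.Λ Z ℓ o a y) (Dt.ν Z ℓ o) :=
    hexp.measurable k g hg U (o, h) hq Z hZ (single Z ℓ) hR 0
  have hbd : ∀ᵐ a ∂(Dt.ν Z ℓ o), ‖Dt.Λ Z ℓ o a‖ * r k ≤ N k g U Z ℓ := hN k g hg U (o, h) hq Z hZ (single Z ℓ) hR 0
  have hA : ∫ a, ‖Dt.Φ Z ℓ o a‖ * ‖Complex.exp (Dt.Λ Z ℓ o a h)‖ ∂(Dt.ν Z ℓ o) ≤ A k g U Z ℓ :=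
    habs k g hg U (o, h) hq Z hZ (single Z ℓ) hR 0
  have hA' : ∫ a, ‖Dt.Φ Z ℓ o a‖ * ‖Complex.exp (Dt.Λ Z ℓ o a h')‖ ∂(Dt.ν Z ℓ o) ≤ A k g U Z ℓ :=
    habs k g hg U (o, h') hq' Z hZ (single Z ℓ) hR 0
  have hΛ : ∀ᵐ a ∂(Dt.ν Z ℓ o), ‖Dt.Λ Z ℓ o a‖ ≤ N k g U Z ℓ / r k := by
    filter_upwards [hbd] with a ha
    exact (le_div_iff₀ (hr k)).2 ha
  have key := norm_integral_mul_cexp_sub_le (Dt.ν Z ℓ o) (Dt.Φ Z ℓ o) (Dt.Λ Z ℓ o) hint hmeas hΛ h' h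
  have hNr : 0 ≤ N k g U Z ℓ / r k * ‖h - h'‖ := mul_nonneg (div_nonneg (hN0 k g U Z ℓ) (hr k).le) (norm_nonneg _)
  rw [hrepr, hrepr']
  calc ‖(∫ a, Dt.Φ Z ℓ o a * Complex.exp (Dt.Λ Z ℓ o a h) ∂(Dt.ν Z ℓ o)) -
          ∫ a, Dt.Φ Z ℓ o a * Complex.exp (Dt.Λ Z ℓ o a h') ∂(Dt.ν Z ℓ o)‖
      ≤ N k g U Z ℓ / r k * ‖h - h'‖ *
          ((∫ a, ‖Dt.Φ Z ℓ o a‖ * ‖Complex.exp (Dt.Λ Z ℓ o a h')‖ ∂(Dt.ν Z ℓ o)) +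
            ∫ a, ‖Dt.Φ Z ℓ o a‖ * ‖Complex.exp (Dt.Λ Z ℓ o a h)‖ ∂(Dt.ν Z ℓ o)) := key
    _ ≤ N k g U Z ℓ / r k * ‖h - h'‖ * (A k g U Z ℓ + A k g U Z ℓ) :=
        mul_le_mul_of_nonneg_left (add_le_add hA' hA) hNr
    _ = 2 * N k g U Z ℓ * A k g U Z ℓ / r k * ‖h - h'‖ := by ring

/-- [folklore] **THE HISTORY SECANT OF ONE ACTIVITY** `H(Z) = Σ_{ℓ ∈ innerLabels D k Z} act Z ℓ o h` (NE5's `B13OutKPForm.activity`)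
from the same three shapes: `‖activity D act k o h Z − activity D act k o h′ Z‖ ≤ secMod D (N k g U) (A k g U) (r k) k Z·‖h − h′‖`.
This is EXACTLY the NE5-side hypothesis `hH` of `NE9ChartFaceTable.tableTwoPoint_actNE9`, produced. [cite: Balaban1988RG2Cluster, (2.9)-(2.15) pp.14-15] -/
theorem norm_activity_sub_activity_le_of_shapes {K : ℕ → (ℕ → ℝ) → C.BgB → Set (Op × Hist)} {W : Set (ℕ → ℝ)}
    {Dt : ActData C.Dom (InnerLabel C.Dom Bnd) Op Hist Ω} {r : ℕ → ℝ}
    {N A : ℕ → (ℕ → ℝ) → C.BgB → C.Dom → InnerLabel C.Dom Bnd → ℝ}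
    (hexp : ActExpLinearOn (labelsIndexing G D) act Dt K W) (hN : ActExpNormBound (labelsIndexing G D) Dt K W r N)
    (habs : ActAbsBound (labelsIndexing G D) Dt K W A) (hN0 : ∀ k g U Z ℓ, 0 ≤ N k g U Z ℓ) (hr : ∀ k, 0 < r k)
    {k : ℕ} {g : ℕ → ℝ} (hg : g ∈ W) {U : C.BgB} {o : Op} {h h' : Hist} (hq : (o, h) ∈ K k g U) (hq' : (o, h') ∈ K k g U)
    {Z : C.Dom} (hZ : C.scale Z = k) :
    ‖activity D act k o h Z - activity D act k o h' Z‖ ≤ secMod D (N k g U) (A k g U) (r k) k Z * ‖h - h'‖ := by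
  simp only [activity, secMod]
  rw [← Finset.sum_sub_distrib, Finset.sum_mul]
  exact (norm_sum_le _ _).trans
    (Finset.sum_le_sum fun ℓ hℓ => norm_act_sub_act_le_of_shapes hexp hN habs hN0 hr hg hq hq' hZ hℓ)

end Secant

/-! ## §3 On the carriers of record: the table two-point clause of `actNE9` ∕ `actChart … (iRecC …)` from NE5's shapes -/

section Record

open Summit.QuantumFields.BalabanUV.T4Continuum.B13Carriers (TwoRuns)
open Summit.QuantumFields.BalabanUV.T4Continuum.B13DomainGeometryTR (SCube footprint domainGeometry)
open Summit.QuantumFields.BalabanUV.T4Continuum.B13InnerData (b13InnerData Bnd)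
open Summit.QuantumFields.BalabanUV.T4Continuum.B13OpDatum (OpDatum)
open Summit.QuantumFields.BalabanUV.T4Continuum.B13StepOfRecord (Slots)
open Summit.QuantumFields.BalabanUV.T4Continuum.B13HistMeasurable (MeasPotFrame)
open Summit.QuantumFields.BalabanUV.T4Continuum.B13HistDatum (PotIdx)
open Summit.QuantumFields.BalabanUV.T4Continuum.U3PolymerDictionaryNE9Face (actNE9 actNE9_footprint)
open Summit.QuantumFields.BalabanUV.T4Continuum.NE9ChartFaceOperator (oRecChart actChart)
open Summit.QuantumFields.BalabanUV.T4Continuum.NE9ChartFaceTable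

variable {G : Type} [GaugeGroup G] {R : TwoRuns G} {E : Type} {IOp Hist : Type*} [NormedAddCommGroup Hist] [NormedSpace ℂ Hist]
  {Ω : Type*} [MeasurableSpace Ω] (S : Slots R E IOp Hist)

/-- [folklore] **A1's TABLE CLAUSE FOR `actNE9` FROM NE5's DISPLAYED SHAPES.**  Inputs: NE5's `ActExpLinearOn` ∕ `ActExpNormBound … r N`
∕ `ActAbsBound … A` for `S.act` on a class `K` over a window `W₅ ⊇ W` (THE binders `hexp ∕ hN ∕ habs` of NE5's END of record),
`N, A ≥ 0`, `r > 0`; a TABLE-BLIND operator sourcing map `oRec` (D-6); a history sourcing map `iRec` Lipschitz `L k ≥ 0` on `𝒜 k`;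
the chart-sourced pairs IN NE5's CLASS: `(oRec k (g k) ξ Q, iRec k (g k) ξ Q) ∈ K (k+1) g (υ ξ)` for `g ∈ W`, `Q ∈ 𝒜 k`, chart points `ξ` (DISPLAYED;
`υ` = the real background indexing the class); the CURRENCY DOMINATION `secMod … (k+1) Z ≤ lipH k·n₅ k (g k) ξ Z` on `R.domAt (k+1)`
(DISPLAYED).  Output: clause (ii) of `U3PolymerDictionaryKP.twoPointKP_cubeChart_of_domains` for `actNE9 S oRec iRec` at footprints
with `lip k := lipH k·L k`, majorant `n₅`. [cite: Balaban1988RG2Cluster, (2.14)-(2.15) p.15 and Lemma 3 (2.38) p.20] -/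
theorem tableTwoPoint_actNE9_of_shapes {Bg : Type} {Pot : Type*} [NormedAddCommGroup Pot] {W W₅ : Set (ℕ → ℝ)} (hW : W ⊆ W₅)
    (oRec : ℕ → ℝ → Bg → Pot → OpDatum E) (iRec : ℕ → ℝ → Bg → Pot → Hist) {𝒜 : ℕ → Set Pot}
    {K : ℕ → (ℕ → ℝ) → R.carriers.BgB → Set (OpDatum E × Hist)}
    {Dt : ActData R.carriers.Dom (InnerLabel R.carriers.Dom (Bnd R)) (OpDatum E) Hist Ω} {r : ℕ → ℝ}
    {N A : ℕ → (ℕ → ℝ) → R.carriers.BgB → R.carriers.Dom → InnerLabel R.carriers.Dom (Bnd R) → ℝ}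
    (hexp : ActExpLinearOn (labelsIndexing (domainGeometry R) (b13InnerData R)) S.act Dt K W₅)
    (hN : ActExpNormBound (labelsIndexing (domainGeometry R) (b13InnerData R)) Dt K W₅ r N)
    (habs : ActAbsBound (labelsIndexing (domainGeometry R) (b13InnerData R)) Dt K W₅ A)
    (hN0 : ∀ k g U Z ℓ, 0 ≤ N k g U Z ℓ) (hA0 : ∀ k g U Z ℓ, 0 ≤ A k g U Z ℓ) (hr : ∀ k, 0 < r k)
    (hbl : ∀ (k : ℕ) (s : ℝ) (ξ : Bg) (Q Q' : Pot), oRec k s ξ Q = oRec k s ξ Q')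
    {L : ℕ → ℝ} (hL0 : ∀ k, 0 ≤ L k)
    (hL : ∀ (k : ℕ) (s : ℝ) (ξ : Bg), ∀ Q ∈ 𝒜 k, ∀ Q' ∈ 𝒜 k, ‖iRec k s ξ Q - iRec k s ξ Q'‖ ≤ L k * ‖Q - Q'‖)
    (υ : Bg → R.carriers.BgB)
    (hcls : ∀ g ∈ W, ∀ (k : ℕ) (ξ : Bg), ∀ Q ∈ 𝒜 k, (oRec k (g k) ξ Q, iRec k (g k) ξ Q) ∈ K (k + 1) g (υ ξ))
    {n₅ : ℕ → ℝ → Bg → R.carriers.Dom → ℝ} {lipH : ℕ → ℝ}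
    (hdom : ∀ g ∈ W, ∀ (k : ℕ) (ξ : Bg), ∀ Z ∈ R.domAt (k + 1),
      secMod (b13InnerData R) (N (k + 1) g (υ ξ)) (A (k + 1) g (υ ξ)) (r (k + 1)) (k + 1) Z ≤ lipH k * n₅ k (g k) ξ Z) :
    ∀ g ∈ W, ∀ (k : ℕ) (ξ : Bg) (X : R.carriers.Dom), R.carriers.scale X = k + 1 → ∀ Q ∈ 𝒜 k, ∀ Q' ∈ 𝒜 k,
      ∀ Z ∈ R.domAt X.1,
        ‖actNE9 S oRec iRec k (g k) ξ Q (footprint Z) - actNE9 S oRec iRec k (g k) ξ Q' (footprint Z)‖ ≤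
          lipH k * L k * ‖Q - Q'‖ * n₅ k (g k) ξ Z := by
  intro g hg k ξ X hX Q hQ Q' hQ' Z hZ
  have hX1 : X.1 = k + 1 := hX
  rw [hX1] at hZ
  have hZs : R.carriers.scale Z = k + 1 := R.mem_domAt.1 hZ
  rw [actNE9_footprint, actNE9_footprint, hbl k (g k) ξ Q' Q]
  have hq := hcls g hg k ξ Q hQ
  have hq' := hcls g hg k ξ Q' hQ'
  rw [hbl k (g k) ξ Q' Q] at hq'
  have hsec := norm_activity_sub_activity_le_of_shapes (G := domainGeometry R) (D := b13InnerData R) (act := S.act) hexp hN habs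
    hN0 hr (hW hg) hq hq' hZs
  have hmod0 : 0 ≤ secMod (b13InnerData R) (N (k + 1) g (υ ξ)) (A (k + 1) g (υ ξ)) (r (k + 1)) (k + 1) Z :=
    secMod_nonneg (b13InnerData R) (fun Z ℓ => hN0 _ _ _ Z ℓ) (fun Z ℓ => hA0 _ _ _ Z ℓ) (hr _) _ Z
  have hLQ : 0 ≤ L k * ‖Q - Q'‖ := mul_nonneg (hL0 k) (norm_nonneg _)
  calc ‖activity (b13InnerData R) S.act (k + 1) (oRec k (g k) ξ Q) (iRec k (g k) ξ Q) Z -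
          activity (b13InnerData R) S.act (k + 1) (oRec k (g k) ξ Q) (iRec k (g k) ξ Q') Z‖
      ≤ secMod (b13InnerData R) (N (k + 1) g (υ ξ)) (A (k + 1) g (υ ξ)) (r (k + 1)) (k + 1) Z *
          ‖iRec k (g k) ξ Q - iRec k (g k) ξ Q'‖ := hsec
    _ ≤ (lipH k * n₅ k (g k) ξ Z) * (L k * ‖Q - Q'‖) :=
        mul_le_mul (hdom g hg k ξ Z hZ) (hL k _ ξ Q hQ Q' hQ') (norm_nonneg _) (hmod0.trans (hdom g hg k ξ Z hZ))
    _ = lipH k * L k * ‖Q - Q'‖ * n₅ k (g k) ξ Z := by ring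

/-- [folklore] **A1's TABLE CLAUSE AT THE CHART FACE WITH THE SOURCING MAP OF RECORD, FROM NE5's SHAPES**: §3's theorem for
`act := actChart S raw ch (iRecC P c w)` (`oRecChart` table-blind by `rfl`, `iRecC` Lipschitz `combWt w` on regular tables —
`NE9ChartFaceTable`) under REG `𝒜 k ⊆ regTables P (c k ξ) w`: clause (ii) with `lip k := lipH k·combWt w`.  With this, WALL §2
row A1's table clause is K modulo NE5's displayed `hexp ∕ hN ∕ habs`, the class membership `hcls`, the domination `hdom` and REG.
[cite: Balaban1988RG2Cluster, (1.34)-(1.36) p.9, (2.14)-(2.15) p.15 and Lemma 3 (2.38) p.20] -/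
theorem tableTwoPoint_actChart_iRecC_of_shapes {P : MeasPotFrame R.carriers} (S : Slots R E IOp (B13HistMeasurable.B13HistM P))
    {ι τ : Type*} [Fintype τ] {Bg TD : Type} {W W₅ : Set (ℕ → ℝ)} (hW : W ⊆ W₅)
    (raw : (ℕ → ℝ) → TD → ℕ → E → ℂ) (ch : Bg → TD) (c : ℕ → Bg → PotIdx P.toPotFrame → τ → ι) (w : τ → ℂ)
    {𝒜 : ℕ → Set (lp (fun _ : ι => ℂ) ⊤)}
    {K : ℕ → (ℕ → ℝ) → R.carriers.BgB → Set (OpDatum E × B13HistMeasurable.B13HistM P)}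
    {Dt : ActData R.carriers.Dom (InnerLabel R.carriers.Dom (Bnd R)) (OpDatum E) (B13HistMeasurable.B13HistM P) Ω} {r : ℕ → ℝ}
    {N A : ℕ → (ℕ → ℝ) → R.carriers.BgB → R.carriers.Dom → InnerLabel R.carriers.Dom (Bnd R) → ℝ}
    (hexp : ActExpLinearOn (labelsIndexing (domainGeometry R) (b13InnerData R)) S.act Dt K W₅)
    (hN : ActExpNormBound (labelsIndexing (domainGeometry R) (b13InnerData R)) Dt K W₅ r N)
    (habs : ActAbsBound (labelsIndexing (domainGeometry R) (b13InnerData R)) Dt K W₅ A)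
    (hN0 : ∀ k g U Z ℓ, 0 ≤ N k g U Z ℓ) (hA0 : ∀ k g U Z ℓ, 0 ≤ A k g U Z ℓ) (hr : ∀ k, 0 < r k)
    (hREG : ∀ (k : ℕ) (ξ : Bg), 𝒜 k ⊆ regTables P (c k ξ) w)
    (υ : Bg → R.carriers.BgB)
    (hcls : ∀ g ∈ W, ∀ (k : ℕ) (ξ : Bg), ∀ Q ∈ 𝒜 k,
      (oRecChart S raw ch k (g k) ξ Q, iRecC P c w k (g k) ξ Q) ∈ K (k + 1) g (υ ξ))
    {n₅ : ℕ → ℝ → Bg → R.carriers.Dom → ℝ} {lipH : ℕ → ℝ}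
    (hdom : ∀ g ∈ W, ∀ (k : ℕ) (ξ : Bg), ∀ Z ∈ R.domAt (k + 1),
      secMod (b13InnerData R) (N (k + 1) g (υ ξ)) (A (k + 1) g (υ ξ)) (r (k + 1)) (k + 1) Z ≤ lipH k * n₅ k (g k) ξ Z) :
    ∀ g ∈ W, ∀ (k : ℕ) (ξ : Bg) (X : R.carriers.Dom), R.carriers.scale X = k + 1 → ∀ Q ∈ 𝒜 k, ∀ Q' ∈ 𝒜 k,
      ∀ Z ∈ R.domAt X.1,
        ‖actChart S raw ch (iRecC P c w) k (g k) ξ Q (footprint Z) - actChart S raw ch (iRecC P c w) k (g k) ξ Q' (footprint Z)‖ ≤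
          lipH k * combWt w * ‖Q - Q'‖ * n₅ k (g k) ξ Z :=
  tableTwoPoint_actNE9_of_shapes S hW (oRecChart S raw ch) (iRecC P c w) hexp hN habs hN0 hA0 hr (oRecChart_tableBlind S raw ch)
    (fun _ => combWt_nonneg w) (fun k s ξ _ hQ _ hQ' => norm_iRecC_sub_le_of_mem s (hREG k ξ hQ) (hREG k ξ hQ')) υ hcls hdom

end Record

end Summit.QuantumFields.BalabanUV.T4Continuum.NE9ChartFaceActivitySecant

end
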